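import Summits.Ventures.Crystal3D.Theorems.StickyWulffConstantNoReconstructionGainExactCriminalBuried
import Summits.Ventures.Crystal3D.Theorems.StickyWulffConstantNoReconstructionGainExactPrep
import Literature.Geometry.DiscreteGeometry.SphericalCodeHullEulerFormula
import Mathlib.Analysis.LocallyConvex.Separation
import Mathlib.Analysis.Normed.Affine.AddTorsorBases
import HarnessLib

/-!
# The buried ball's contact shell obeys spherical Euler: at most `3d − 6` touching pairs (line `replication-exactness`)

HONEST FRAMING. Part of the venture `Summits/Ventures/Crystal3D` (cell `crystal3d-full`), supports the
crux `NoReconstructionGain` (stmt-Ventures-19144, route `route-Ventures-StickyWulffConstant`), line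
`replication-exactness` (lead wulff-p1 g18).  Anatomy of minimal counterexamples to EXACT₀, using
the PROVED spherical Euler bound of the tree (`card_contactPairsAt_le`,
`Literature/Geometry/DiscreteGeometry/SphericalCodeHullEulerFormula`: a finite set of unit vectors
with `0` interior to its hull and pairwise inner products `≤ κ` has at most `3N − 6` pairs at level
`κ`).  A film ball with at least ten partners is surrounded (`exists_partner_neg_side_of_ten`,
`…ExactCriminalBuried`), i.e. its partner directions see every open half-space; by separation this
puts `0` in the interior of their hull.

* `zero_mem_interior_convexHull_of_twoSided` — separation lemma: a finite `X ⊂ ℝ³` meeting every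
  open half-space `{⟪e,·⟫ < 0}` has `0 ∈ interior (conv X)`;
* `card_contactPairs_partners_le` — for a film ball `q` with `≥ 10` partners (plugs + film balls at
  distance `1`), the partner DIRECTIONS `x − q` form a spherical code with pairwise inner products
  `≤ 1/2` whose contact pairs (= touching pairs of partners) number at most `3d − 6`, `d` = number
  of partners; in particular for the heavy ball of a criminal.

WHAT THIS IS NOT: the crux; rung F-C1 not moved.
-/

noncomputable section

namespace Summit.Ventures.Crystal3D.Theorems

open Summit.Ventures.Crystal3D
open Literature.MathematicalPhysics.StatisticalMechanics (fccStacking isHaggSeq_const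
  le_dist_of_mem_barlowStacking_ideal)
open Literature.Geometry.DiscreteGeometry (contactPairsAt card_contactPairsAt_le)
open scoped InnerProductSpace
open Finset

/-- **Separation lemma.**  A finite set of `ℝ³` meeting every open half-space through `0` has `0`
in the interior of its convex hull. -/
theorem zero_mem_interior_convexHull_of_twoSided {X : Finset (EuclideanSpace ℝ (Fin 3))}
    (h : ∀ e : EuclideanSpace ℝ (Fin 3), e ≠ 0 → ∃ x ∈ X, ⟪e, x⟫_ℝ < 0) :
    (0 : EuclideanSpace ℝ (Fin 3)) ∈ interior (convexHull ℝ (X : Set (EuclideanSpace ℝ (Fin 3)))) := by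
  by_contra h0
  set C := convexHull ℝ (X : Set (EuclideanSpace ℝ (Fin 3))) with hC
  have hCconv : Convex ℝ C := convex_convexHull ℝ _
  by_cases hne : (interior C).Nonempty
  · -- separate `0` from the open convex set `interior C`
    obtain ⟨f, hf⟩ := geometric_hahn_banach_open_point hCconv.interior isOpen_interior h0
    set e := (InnerProductSpace.toDual ℝ (EuclideanSpace ℝ (Fin 3))).symm f with he
    have hfe : ∀ a, f a = ⟪e, a⟫_ℝ := fun a => by rw [he, InnerProductSpace.toDual_symm_apply]
    have hle : ∀ a ∈ C, f a ≤ 0 := by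
      intro a ha
      have hcl : a ∈ closure (interior C) := by
        rw [hCconv.closure_interior_eq_closure_of_nonempty_interior hne]; exact subset_closure ha
      have hclosed : IsClosed {a : EuclideanSpace ℝ (Fin 3) | f a ≤ 0} :=
        isClosed_le f.continuous continuous_const
      exact closure_minimal (fun a ha => by have := hf a ha; rw [map_zero] at this; exact this.le)
        hclosed hcl
    have he0 : e ≠ 0 := by
      intro he0
      obtain ⟨a, ha⟩ := hne
      have := hf a ha
      rw [map_zero, hfe, he0, inner_zero_left] at this
      exact lt_irrefl _ this
    obtain ⟨x, hx, hneg⟩ := h (-e) (neg_ne_zero.2 he0)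
    have hxC : x ∈ C := subset_convexHull ℝ _ hx
    have := hle x hxC
    rw [hfe] at this
    rw [inner_neg_left] at hneg
    linarith
  · -- `C` lies in a proper affine subspace: a nonzero normal is constant on `X`
    have hX : X.Nonempty := by
      obtain ⟨x, hx, -⟩ := h (EuclideanSpace.single 0 1) (by
        intro h0'; have := congrArg (fun v => v 0) h0'; simp at this)
      exact ⟨x, hx⟩
    obtain ⟨x₀, hx₀⟩ := hX
    have htop : affineSpan ℝ C ≠ ⊤ := fun htop' =>
      hne (hCconv.interior_nonempty_iff_affineSpan_eq_top.2 htop')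
    set A := affineSpan ℝ C with hA
    have hx₀A : x₀ ∈ A := mem_affineSpan ℝ (subset_convexHull ℝ _ hx₀)
    have hdir : A.direction ≠ ⊤ := by
      rwa [Ne, AffineSubspace.direction_eq_top_iff_of_nonempty ⟨x₀, hx₀A⟩]
    have horth : A.directionᗮ ≠ ⊥ := by
      rwa [Ne, Submodule.orthogonal_eq_bot_iff]
    obtain ⟨e, he, he0⟩ := Submodule.exists_mem_ne_zero_of_ne_bot horth
    have hconst : ∀ x ∈ X, ⟪e, x⟫_ℝ = ⟪e, x₀⟫_ℝ := by
      intro x hx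
      have hxA : x ∈ A := mem_affineSpan ℝ (subset_convexHull ℝ _ hx)
      have hd : x -ᵥ x₀ ∈ A.direction := AffineSubspace.vsub_mem_direction hxA hx₀A
      rw [vsub_eq_sub] at hd
      have := Submodule.inner_left_of_mem_orthogonal hd he
      rw [inner_sub_right, sub_eq_zero] at this
      exact this
    obtain ⟨x, hx, h1⟩ := h e he0
    obtain ⟨y, hy, h2⟩ := h (-e) (neg_ne_zero.2 he0)
    rw [inner_neg_left, hconst y hy] at h2
    rw [hconst x hx] at h1
    linarith

open scoped Classical in
/-- **Spherical Euler for a surrounded contact shell.**  For a film ball `q` with at least ten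
partners, the partner directions `x − q` (unit vectors, pairwise inner product `≤ 1/2`) have at most
`3d − 6` contact pairs (pairs at inner product `1/2`, i.e. touching partners), `d` the number of
partners. -/
theorem card_contactPairs_partners_le {ν : EuclideanSpace ℝ (Fin 3)} {s : ℝ}
    {Q : Finset (EuclideanSpace ℝ (Fin 3))} (hQ : IsFilmOn ν s Q) {q : EuclideanSpace ℝ (Fin 3)}
    (h10 : 10 ≤ (plugSet ν s q).ncard + (Q.filter fun y => dist q y = 1).card) :
    (contactPairsAt (((plugSet_finite ν s q).toFinset ∪ Q.filter fun y => dist q y = 1).image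
        fun x => x - q) (1 / 2)).card + 6 ≤
      3 * ((plugSet_finite ν s q).toFinset ∪ Q.filter fun y => dist q y = 1).card := by
  have hfin := plugSet_finite ν s q
  set T := hfin.toFinset ∪ Q.filter fun y => dist q y = 1 with hT
  have hTmem : ∀ x ∈ T, (x ∈ plugSet ν s q ∨ (x ∈ Q ∧ dist q x = 1)) ∧ dist q x = 1 := by
    intro x hx
    rw [hT, Finset.mem_union, Set.Finite.mem_toFinset, Finset.mem_filter] at hx
    rcases hx with hx | hx
    · exact ⟨Or.inl hx, hx.2⟩
    · exact ⟨Or.inr hx, hx.2⟩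
  -- distinct partners are at distance `≥ 1`
  have hfar : ∀ x ∈ T, ∀ y ∈ T, x ≠ y → 1 ≤ dist x y := by
    intro x hx y hy hne
    rcases (hTmem x hx).1 with hx' | ⟨hxQ, -⟩ <;> rcases (hTmem y hy).1 with hy' | ⟨hyQ, -⟩
    · exact le_dist_of_mem_barlowStacking_ideal isHaggSeq_const one_pos fcc_height_sq hx'.1.1
        hy'.1.1 hne
    · rw [dist_comm]; exact hQ.2 y hyQ x hx'.1
    · exact hQ.2 x hxQ y hy'.1
    · exact hQ.1 x hxQ y hyQ hne
  set X := T.image fun x => x - q with hX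
  have hinj : Function.Injective fun x : EuclideanSpace ℝ (Fin 3) => x - q := sub_left_injective
  have hcard : X.card = T.card := Finset.card_image_of_injective _ hinj
  have hX1 : ∀ u ∈ X, ‖u‖ = 1 := by
    intro u hu
    obtain ⟨x, hx, rfl⟩ := Finset.mem_image.1 hu
    rw [← dist_eq_norm, dist_comm]; exact (hTmem x hx).2
  have hXκ : ∀ u ∈ X, ∀ v ∈ X, u ≠ v → ⟪u, v⟫_ℝ ≤ 1 / 2 := by
    intro u hu v hv hne
    obtain ⟨x, hx, rfl⟩ := Finset.mem_image.1 hu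
    obtain ⟨y, hy, rfl⟩ := Finset.mem_image.1 hv
    have hxy : x ≠ y := fun h => hne (by rw [h])
    have hd := hfar x hx y hy hxy
    have hux := hX1 _ hu
    have hvy := hX1 _ hv
    have e1 : dist x y ^ 2 = ‖(x - q) - (y - q)‖ ^ 2 := by
      rw [dist_eq_norm]; congr 2; abel
    rw [norm_sub_sq_real, hux, hvy] at e1
    nlinarith [hd]
  have h0 : (0 : EuclideanSpace ℝ (Fin 3)) ∈ interior (convexHull ℝ (X : Set (EuclideanSpace ℝ (Fin 3)))) := by
    refine zero_mem_interior_convexHull_of_twoSided fun e he => ?_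
    have hne : ‖e‖ ≠ 0 := norm_ne_zero_iff.2 he
    have hunit : ‖(‖e‖⁻¹ • e : EuclideanSpace ℝ (Fin 3))‖ = 1 := by
      rw [norm_smul, norm_inv, norm_norm, inv_mul_cancel₀ hne]
    obtain ⟨x, hx, hlt⟩ := exists_partner_neg_side_of_ten hQ h10 hunit
    refine ⟨x - q, Finset.mem_image.2 ⟨x, ?_, rfl⟩, ?_⟩
    · rw [hT, Finset.mem_union, Set.Finite.mem_toFinset, Finset.mem_filter]
      rcases hx with hx | hx
      · exact Or.inl hx
      · exact Or.inr hx
    · rw [inner_smul_left] at hlt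
      simp only [conj_trivial] at hlt
      have hpos : 0 < ‖e‖⁻¹ := inv_pos.2 (norm_pos_iff.2 he)
      exact neg_of_mul_neg_left (by linarith) hpos.le |> fun h => by nlinarith [hlt, hpos]
  have h := card_contactPairsAt_le hX1 h0 (by norm_num : (-1 : ℝ) < 1 / 2) hXκ
  rw [hcard] at h
  exact h

end Summit.Ventures.Crystal3D.Theorems

end
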